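import Mathlib
import Summits.ValiantsHypothesis.ValiantsHypothesis.Theorems.NewtonTauWeak.Negative.Zonogon
import Summits.ValiantsHypothesis.ValiantsHypothesis.Theorems.NewtonUnitEquationsDissociatedUniformStubExposedGenericDirection
import Summits.ValiantsHypothesis.ValiantsHypothesis.Theorems.NewtonUnitEquationsNewtonTauWeakResidueDesignHull

/-!
# Sketch (stub-ideation k3 for `stub_binomialNewtonTauCommon`): typed helper lemmas of the plan
`STUB-IDEAS-stub_binomialNewtonTauCommon-3.md` — the LAGRANGIAN SPINE + ZERO-SUM-FREE CORRECTION normal form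
for ℤ-WEIGHTED LEVEL SETS of subset sums, `X_v = {Σ_{j∈J} d_j : Σ_{j∈J} g_j = v}`, `1 ≤ g_j ≤ c`.
Statements only (`sorry`); elaboration sanity check.  Helper `def`s are the prover's to keep or inline.
-/

set_option linter.dupNamespace false
set_option linter.unusedVariables false

noncomputable section

open scoped BigOperators Classical
open MvPolynomial
open Summit.ValiantsHypothesis.ValiantsHypothesis.Theorems.NewtonTauWeak.Negative (vert)

namespace Summit.ValiantsHypothesis.ValiantsHypothesis.Cruxes.NewtonTauWeak.WeightedLevelSet

variable {N : ℕ}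

/-- weight of a set of items -/
def wt (g : Fin N → ℕ) (S : Finset (Fin N)) : ℕ := ∑ j ∈ S, g j

/-- `j'` strictly precedes `j` in DENSITY order `c_j / g_j` (cross-multiplied, ties broken by the index). -/
def DensLT (c : Fin N → ℝ) (g : Fin N → ℕ) (j' j : Fin N) : Prop :=
  c j * g j' < c j' * g j ∨ (c j' * g j = c j * g j' ∧ j' < j)

/-- density rank of `j` = number of items strictly before it -/
def drank (c : Fin N → ℝ) (g : Fin N → ℕ) (j : Fin N) : ℕ :=
  (Finset.univ.filter fun j' => DensLT c g j' j).card

/-- the top-`k` density prefix -/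
def pre (c : Fin N → ℝ) (g : Fin N → ℕ) (k : ℕ) : Finset (Fin N) :=
  Finset.univ.filter fun j => drank c g j < k

/-- the LAGRANGIAN SPINE for target `v`: the longest density prefix of weight `≤ v` -/
def spine (c : Fin N → ℝ) (g : Fin N → ℕ) (v : ℕ) : Finset (Fin N) :=
  pre c g (Nat.findGreatest (fun k => wt g (pre c g k) ≤ v) N)

/-- CANONICAL CORRECTION of the spine by a count vector `(α, β)` indexed by weight values: in weight class `a`,
drop the `α a` LOWEST items of the spine (key `(c_j, j)`) and add the `β a` HIGHEST items outside it. -/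
def canon (c : Fin N → ℝ) (g : Fin N → ℕ) (v : ℕ) (α β : ℕ → ℕ) : Finset (Fin N) :=
  Finset.univ.filter fun j =>
    (j ∈ spine c g v ∧ α (g j) ≤
        ((spine c g v).filter fun j' => g j' = g j ∧ (c j' < c j ∨ (c j' = c j ∧ j' < j))).card) ∨
    (j ∉ spine c g v ∧
        ((Finset.univ \ spine c g v).filter fun j' => g j' = g j ∧ (c j < c j' ∨ (c j' = c j ∧ j' < j))).card
          < β (g j))

/-- **H1 (S) — zero-sum-free exchanges are short.**  Removed weights `x_i`, added weights `y_i`, all in `[1, c]`,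
net gain `r < c`; if no nonempty sub-family of removals has the same total as a sub-family of additions, then
there are at most `3c` of them (greedy signed partial sums stay in `(-c, c]` and must be distinct). [folklore;
Steinitz/partial-sums argument as in knapsack proximity] -/
theorem zeroSumFree_card_le (p m c r : ℕ) (x : Fin p → ℕ) (y : Fin m → ℕ)
    (hx : ∀ i, 1 ≤ x i ∧ x i ≤ c) (hy : ∀ i, 1 ≤ y i ∧ y i ≤ c)
    (hsum : ∑ i, y i = ∑ i, x i + r) (hr : r < c)
    (hfree : ∀ (S : Finset (Fin p)) (T : Finset (Fin m)), S.Nonempty → ∑ i ∈ S, x i ≠ ∑ i ∈ T, y i) :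
    p + m ≤ 3 * c := by
  sorry

/-- **H2 (M) — weighted exchange normal form (the ℤ-weighted analogue of `stub_residueNormalForm`).**  Every
maximiser of `Σ_{j∈J} c_j` over `{J : wt J = v}` has the value of a canonical set `canon c g v α β` with a SHORT
count vector, `Σ_a (α a + β a) ≤ 3c`.  (Exchange: a removal family and an addition family of equal weight can be
swapped back at no loss because spine densities dominate outside densities; so a maximiser closest to the spine is
zero-sum-free, hence short by H1; inside a weight class heights and densities order alike, so lowest-out /
highest-in is optimal for fixed counts.)  No genericity hypothesis.  Brute-force checked (kit/check_weighted_nf.py,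
3 400 instances with ties, 0 failures; corrections of size `2c - 2` do occur). [folklore: exchange argument] -/
theorem weightedNormalForm (N c v : ℕ) (g : Fin N → ℕ) (hg : ∀ j, 1 ≤ g j ∧ g j ≤ c) (c' : Fin N → ℝ)
    (J : Finset (Fin N)) (hJ : wt g J = v)
    (hmax : ∀ J' : Finset (Fin N), wt g J' = v → ∑ j ∈ J', c' j ≤ ∑ j ∈ J, c' j) :
    ∃ α β : ℕ → ℕ, (∑ a ∈ Finset.range (c + 1), (α a + β a) ≤ 3 * c) ∧
      (∀ a, (a = 0 ∨ c < a) → α a = 0 ∧ β a = 0) ∧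
      (∀ a, α a ≤ 3 * c ∧ β a ≤ 3 * c) ∧
      wt g (canon c' g v α β) = v ∧ ∑ j ∈ canon c' g v α β, c' j = ∑ j ∈ J, c' j := by
  sorry

/-- **H3 (S/M) — the canonical set only sees the sign vector of the `N²` DENSITY functionals
`w ↦ ⟨w, g_j • d_{j'} - g_{j'} • d_j⟩` (verbatim analogue of `ResidueDesignHullAux.canonical_eq_of_signs`;
within a weight class the same functional orders heights).** -/
theorem canon_eq_of_signs (N v : ℕ) (g : Fin N → ℕ) (hg : ∀ j, 1 ≤ g j) :
    ∃ F : (Fin (N * N) → SignType) → (ℕ → ℕ) → (ℕ → ℕ) → Finset (Fin N),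
      ∀ (c' : Fin N → ℝ) (α β : ℕ → ℕ) (σ : Fin (N * N) → SignType),
        (∀ j' j, σ (finProdFinEquiv (j', j)) = SignType.sign (c' j' * g j - c' j * g j')) →
        canon c' g v α β = F σ α β := by
  sorry

/-- **H4 (M/L) — THEOREM W: hull vertices of ℤ-weighted level sets of subset sums.**  For weights
`1 ≤ g_j ≤ c` and any exponents `d_j` (coincidences allowed),
`#vert conv {Σ_{j∈J} d_j : Σ_{j∈J} g_j = v} ≤ (4 N² + 5) · (3c + 1)^{2c}` — polynomial in `N` with degree 2
for every fixed `c`, uniformly in `v`.  Assembly exactly as `stub_residueDesignHull`: strictly exposing direction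
(`stub_exposedGenericDirection`, `T = ∅`) → H2 → H3 → `ResidueDesignHullAux.signvec_plane_count` with `M = N·N`
→ count vectors in the box `[0, 3c]^{2c}`. -/
theorem weightedLevelSetHull (N c v : ℕ) (g : Fin N → ℕ) (hg : ∀ j, 1 ≤ g j ∧ g j ≤ c)
    (d : Fin N → (Fin 2 →₀ ℕ)) :
    (Set.extremePoints ℝ (convexHull ℝ ((fun e : Fin 2 →₀ ℕ => fun i : Fin 2 => ((e i : ℕ) : ℝ)) ''
      (((Finset.univ.filter fun J : Finset (Fin N) => ∑ j ∈ J, g j = v).image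
        fun J => ∑ j ∈ J, d j : Finset (Fin 2 →₀ ℕ)) : Set (Fin 2 →₀ ℕ))))).ncard ≤
      (4 * (N * N) + 5) * (3 * c + 1) ^ (2 * c) := by
  sorry

/-- **H5 (M) — the stub's inequality on the family 𝓖_c of GRADED DESIGNS** (dissociated list, nonzero `ρ`,
ARBITRARY nodes `u_l` and scalars `cf_l`, any number `K` of products): the design
`f = Σ_l cf_l Π_j (1 - u_l^{g_j} ρ_j X^{d_j})` has coefficient `F(wt J) · Π_{j∈J}(-ρ_j)` at `Σ_J d_j` with
`F(s) = Σ_l cf_l u_l^s`, so `supp f = ⋃_{s ≤ Σ g, F(s) ≠ 0} X_s` is a union of at most `Σ g + 1 ≤ cN + 1` weighted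
level sets and (hull of a union) H4 bounds `vert f` by `(Σ g + 1)(4N²+5)(3c+1)^{2c}` — T2 on 𝓖_c with an exponent
depending on `c` only, uniformly in `K` (level-ISOLATING scalars, `F = [· = v]`, `K = Σ g + 1`, are the special case
that shows the bound is also NECESSARY for the stub up to the `c`-dependence). -/
theorem gradedDesignT2 (N c K : ℕ) (g : Fin N → ℕ) (hg : ∀ j, 1 ≤ g j ∧ g j ≤ c)
    (u cf : Fin K → ℂ) (ρ : Fin N → ℂ) (hρ : ∀ j, ρ j ≠ 0) (d : Fin N → (Fin 2 →₀ ℕ))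
    (hdis : ∀ J J' : Finset (Fin N), ∑ j ∈ J, d j = ∑ j ∈ J', d j → J = J') :
    vert (∑ l, C (cf l) * ∏ j, (1 - C (u l ^ g j * ρ j) * monomial (d j) 1)) ≤
      (∑ j, g j + 1) * ((4 * (N * N) + 5) * (3 * c + 1) ^ (2 * c)) := by
  sorry

/-- **H6 (the prize; OPEN) — `WeightedLevelSetPoly`**: the same count polynomial in `N` AND `c`.  NECESSARY for
the stub (T2 with generic `ρ` realises `X_v` as a support, `K = Σ g + 1 ≤ cN + 1`), and by H1–H4 EQUIVALENT to a
statement about one sign cell: the number of short count vectors `(α, β)` whose canonical point is a hull vertex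
exposed inside the cell is `poly(c)` (candidates are `≥ p(c-1)` zero-sum-free patterns, so counting candidates
cannot give it). -/
def WeightedLevelSetPoly : Prop :=
  ∃ e : ℕ, ∀ (N c v : ℕ) (g : Fin N → ℕ), (∀ j, 1 ≤ g j ∧ g j ≤ c) → ∀ d : Fin N → (Fin 2 →₀ ℕ),
    (Set.extremePoints ℝ (convexHull ℝ ((fun e : Fin 2 →₀ ℕ => fun i : Fin 2 => ((e i : ℕ) : ℝ)) ''
      (((Finset.univ.filter fun J : Finset (Fin N) => ∑ j ∈ J, g j = v).image
        fun J => ∑ j ∈ J, d j : Finset (Fin 2 →₀ ℕ)) : Set (Fin 2 →₀ ℕ))))).ncard ≤ (c * N + 2) ^ e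

/-- **H7 (extremal toy of H6; OPEN, kit-probed) — `PartitionShadowPoly`**: every planar projection
`β ↦ Σ_a β_a • D_a` of the integer-partition polytope `P_n = conv{β : Σ_{a<n} (a+1)·β_a = n}` (`β_a` = multiplicity of
the part `a+1`) has `poly(n)` vertices.
This is H6 with all items of a weight class EQUAL (`N = Σ_{a≤n} ⌊n/a⌋`, `c = v = n`), hence also necessary for the
stub; measured maxima over random multi-scale projections: 11, 16/17, 20, 26, 31 vertices at n = 8, 12, 16, 20, 24
(kit/partition_shadow.py) — linear, ≈ 1.3 n. -/
def PartitionShadowPoly : Prop :=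
  ∃ e : ℕ, ∀ (n : ℕ) (D : Fin n → (Fin 2 →₀ ℕ)),
    (Set.extremePoints ℝ (convexHull ℝ ((fun e : Fin 2 →₀ ℕ => fun i : Fin 2 => ((e i : ℕ) : ℝ)) ''
      ((((Fintype.piFinset fun _ : Fin n => Finset.range (n + 1)).filter
          fun β : Fin n → ℕ => ∑ a : Fin n, ((a : ℕ) + 1) * β a = n).image
        fun β => ∑ a : Fin n, β a • D a : Finset (Fin 2 →₀ ℕ)) : Set (Fin 2 →₀ ℕ))))).ncard ≤ (n + 2) ^ e

/-- Sanity: the stub's statement, verbatim (to make sure the ambient `vert`/`C`/`monomial` are the crux's). -/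
example : Prop :=
  ∃ b : ℕ, ∀ (K N : ℕ) (c : Fin K → ℂ) (ρ : Fin K → Fin N → ℂ) (d : Fin N → (Fin 2 →₀ ℕ)),
    vert (∑ l, C (c l) * ∏ j, (1 - C (ρ l j) * monomial (d j) 1)) ≤ (K * N + 2) ^ b

end Summit.ValiantsHypothesis.ValiantsHypothesis.Cruxes.NewtonTauWeak.WeightedLevelSet

end
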